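import Summits.ValiantsHypothesis.ValiantsHypothesis.Theorems.LangWeilTransferTameTransferOfSupports
import Summits.ValiantsHypothesis.ValiantsHypothesis.Theorems.LangWeilTransferAssembly

/-!
# LangWeilTransfer — the summit from EXACTLY the route's open items (record after the assembly)

Route `LangWeilTransfer` of `ValiantsHypothesis`. With `Assembly` (stmt-6382, `assembly_proof`),
`ScalarRestriction`, `LangWeilBound`, `TransferGlue`, `UniversalGlue` all theorems of the tree, the
deciding theorem `closes` now rests on precisely four open statements: the crux
`ShatteringExclusion` (stmt-6372), the two effective-arithmetic supports `GoodReduction` (stmt-6377;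
its absolutely-irreducible slice is proved) and `TameResolution` (stmt-6378) which feed `TameTransfer`
(stmt-6373) through `tameTransfer_of_goodReduction_of_tameResolution`, and the Boolean conjecture
`SharpPNotPPoly` (stmt-6381, `P^#P ⊄ P/poly`). This file records that edge, superseding
`valiantsHypothesis_of_open_items` (which still took the assembly as a hypothesis).

Honest framing: a CONDITIONAL statement; all four hypotheses are open (two of them research
problems); `VP ≠ VNP` is NOT proved and nothing here is progress on it.
-/

-- the summit and the problem share the name `ValiantsHypothesis` (D-0017 single-conjunct layout)
set_option linter.dupNamespace false

namespace Summit.ValiantsHypothesis.ValiantsHypothesis.Theorems.LangWeilTransfer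

open Summit.ValiantsHypothesis.ValiantsHypothesis.Theses.LangWeilTransfer

/-- **`ValiantsHypothesis` from the four open items of route LangWeilTransfer**:
`ShatteringExclusion → GoodReduction → TameResolution → SharpPNotPPoly → ValiantsHypothesis`
(`closes` with `TameTransfer`, `ScalarRestriction` and `Assembly` discharged by tree theorems).
Conditional bookkeeping only. -/
theorem valiantsHypothesis_of_open_cruxes (hSE : ShatteringExclusion) (hGR : GoodReduction)
    (hTR : TameResolution) (hSharpP : SharpPNotPPoly) : _root_.ValiantsHypothesis :=
  valiantsHypothesis_of_open_items hSE hGR hTR hSharpP assembly_proof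

end Summit.ValiantsHypothesis.ValiantsHypothesis.Theorems.LangWeilTransfer
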